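import Literature.AlgebraicGeometry.Frobenioids.ArithmeticFrobenioidThm64ivNormPreservation
import Mathlib.RingTheory.Ideal.Pointwise
import HarnessLib

/-!
# Frobenioids I, Theorem 6.4 (iv) AT THE CONSTRUCTIONS: the generator bijection `π_X` of `Ψ^Φ_X` is
# EQUIVARIANT for the automorphisms of `X` (finite places)

Mochizuki, *The geometry of Frobenioids I: the general theory*, Kyushu J. Math. **62** (2008) 293–400, §6,
Thm. 6.4 (iv) p. 115 l. 23–29 [cite: MochizukiFrdI2008, Thm. 6.4 (iv) p.115].

PROOF-ONLY file (cell abc-iut, layer L1, seat abc-iut-L1-d3 gen 4; GAP-LEDGER G-L1t3-1 #2 general case, CM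
branch; 0 definitions, no named facts).  Pull-backs of effective arithmetic divisors along field ISOMORPHISMS are
place relabellings (`ramIdxPlace_ringEquiv`, `pullback_ringEquiv_single`), the prime of `underPlace g w` for
`g ∈ Gal(L/ℚ)` is `g⁻¹ • 𝔭_w` (`asIdeal_maximalIdeal_underPlace_algEquiv`), and — from the naturality of
`Ψ^Φ` — the generator-to-generator bijection `π_X` of an equivalence of arithmetic Frobenioids at `X = Spec L₁`
satisfies `π_X (h⁻¹ w) = (Ψ^Base h)⁻¹ (π_X w)` for every `h ∈ Aut_{D₁}(X)` (`arith_finitePlaceTransport_equivariant`).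
Nothing here bears on, or takes a side on, [IUTchIII] Cor. 3.12.
-/

noncomputable section

namespace Literature.AlgebraicGeometry.Frobenioids

open CategoryTheory Opposite NumberField IsDedekindDomain ArithPullback

open scoped Pointwise

/-! ### Pull-backs along isomorphisms are relabellings -/

section Iso

variable {M L : Type} [Field M] [NumberField M] [Field L] [NumberField L]

/-- `τ⁻¹ ∘ τ` and `τ ∘ τ⁻¹` on finite places. [cite: MochizukiFrdI2008, Ex. 6.3 p.113] -/
theorem underPlace_ringEquiv_symm_apply (τ : M ≃+* L) (w : FinitePlace M) :
    underPlace (τ : M →+* L) (underPlace (τ.symm : L →+* M) w) = w := by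
  rw [← underPlace_comp]
  have : ((τ.symm : L →+* M).comp (τ : M →+* L)) = RingHom.id M := by ext x; simp
  rw [this, underPlace_id]

/-- `τ ∘ τ⁻¹` on finite places. [cite: MochizukiFrdI2008, Ex. 6.3 p.113] -/
theorem underPlace_ringEquiv_apply_symm (τ : M ≃+* L) (w : FinitePlace L) :
    underPlace (τ.symm : L →+* M) (underPlace (τ : M →+* L) w) = w := by
  rw [← underPlace_comp]
  have : ((τ : M →+* L).comp (τ.symm : L →+* M)) = RingHom.id L := by ext x; simp
  rw [this, underPlace_id]

/-- Ramification indices along an ISOMORPHISM are `1`. [cite: MochizukiFrdI2008, Ex. 6.3 p.113] -/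
theorem ramIdxPlace_ringEquiv (τ : M ≃+* L) (w : FinitePlace L) : ramIdxPlace (τ : M →+* L) w = 1 := by
  have h1 := ramIdxPlace_comp (τ.symm : L →+* M) (τ : M →+* L) w
  have : ((τ : M →+* L).comp (τ.symm : L →+* M)) = RingHom.id L := by ext x; simp
  rw [this, ramIdxPlace_id] at h1
  exact Nat.eq_one_of_mul_eq_one_left h1.symm

/-- **The pull-back of a generator along an isomorphism is the relabelled generator**:
`τ^* δ_w = δ_{τ-transport of w}`. [cite: MochizukiFrdI2008, Ex. 6.3 p.113] -/
theorem pullback_ringEquiv_single (τ : M ≃+* L) (w : FinitePlace M) :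
    EffArithDivisor.pullback (τ : M →+* L) ((Finsupp.single w 1, 0) : EffArithDivisor M) =
      (Finsupp.single (underPlace (τ.symm : L →+* M) w) 1, 0) := by
  classical
  refine Prod.ext (Finsupp.ext fun w' => ?_) (funext fun v => ?_)
  · rw [EffArithDivisor.pullback_fst, ramIdxPlace_ringEquiv, one_mul]
    change (Finsupp.single w 1 : FinitePlace M →₀ ℕ) (underPlace (τ : M →+* L) w') =
      (Finsupp.single (underPlace (τ.symm : L →+* M) w) 1 : FinitePlace L →₀ ℕ) w'
    by_cases hw : underPlace (τ : M →+* L) w' = w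
    · have hw' : w' = underPlace (τ.symm : L →+* M) w := by
        rw [← hw, underPlace_ringEquiv_apply_symm]
      rw [hw, hw', Finsupp.single_eq_same, Finsupp.single_eq_same]
    · rw [Finsupp.single_eq_of_ne hw, Finsupp.single_eq_of_ne]
      intro h'
      apply hw
      rw [h', underPlace_ringEquiv_symm_apply]
  · rw [EffArithDivisor.pullback_snd]
    rfl

/-- **The prime of `g⁻¹ w` is `g⁻¹ • 𝔭_w`** for `g ∈ Gal(L/ℚ)` acting on the ideals of `𝓞 L`.
[cite: MochizukiFrdI2008, Ex. 6.3 p.113] -/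
theorem asIdeal_maximalIdeal_underPlace_algEquiv (g : L ≃ₐ[ℚ] L) (w : FinitePlace L) :
    (underPlace (g : L →+* L) w).maximalIdeal.asIdeal = g⁻¹ • w.maximalIdeal.asIdeal := by
  rw [maximalIdeal_underPlace, under_asIdeal, Ideal.pointwise_smul_eq_comap, map_inv]
  change _ = Ideal.comap ((MulSemiringAction.toRingAut (L ≃ₐ[ℚ] L) (𝓞 L) g).symm.symm : 𝓞 L →+* 𝓞 L) _
  rw [RingEquiv.symm_symm]
  congr 1

end Iso

/-! ### Equivariance of `π_X` at the finite places -/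

section Arith

variable {F₁ : Type} [Field F₁] [NumberField F₁] {K₁ : Type} [Field K₁] [Algebra F₁ K₁] [IsGalois F₁ K₁]
variable {F₂ : Type} [Field F₂] [NumberField F₂] {K₂ : Type} [Field K₂] [Algebra F₂ K₂] [IsGalois F₂ K₂]

/-- An `F`-algebra endomorphism of a finite extension, as a ring isomorphism. [cite: MochizukiFrdI2008, Thm. 6.4 (iv) p.115] -/
theorem exists_ringEquiv_coe_eq {F L : Type} [Field F] [Field L] [Algebra F L] [FiniteDimensional F L]
    (f : L →ₐ[F] L) : ∃ τ : L ≃+* L, (τ : L →+* L) = (f : L →+* L) :=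
  ⟨(AlgEquiv.ofBijective f (Algebra.IsAlgebraic.algHom_bijective f)).toRingEquiv, rfl⟩

omit [IsGalois F₁ K₁] [IsGalois F₂ K₂] in
/-- **`π_X` is equivariant at the finite places**: for the generator-to-generator bijection `π = π_X` of an
equivalence `Ψ` of arithmetic Frobenioids with Cor. 4.11 (iv) datum and every `h ∈ Aut_{D₁}(X)`,
`π (h⁻¹ w) = (Ψ^Base h)⁻¹ (π w)` — in `underPlace` form (naturality of `Ψ^Φ` on the generator `δ_{h⁻¹ w}`).
[cite: MochizukiFrdI2008, Thm. 6.4 (iv) p.115] -/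
theorem arith_finitePlaceTransport_equivariant {ΨBase : FinSubextCat F₁ K₁ ⥤ FinSubextCat F₂ K₂}
    (E : PreFrobenioidData.DivisorMonoidIsoOverBase (arithFrobenioidOps F₁ K₁) (arithFrobenioidOps F₂ K₂) ΨBase)
    (X : FinSubextCat F₁ K₁) (π : FinitePlace X.L → FinitePlace (ΨBase.obj X).L)
    (hπ : ∀ w : FinitePlace X.L,
      E.iso X (Multiplicative.ofAdd (EffArithDivisor.single X.L (Sum.inr w))) =
        Multiplicative.ofAdd (EffArithDivisor.single (ΨBase.obj X).L (Sum.inr (π w))))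
    (h : X ⟶ X) (w : FinitePlace X.L) :
    π (underPlace (h.toAlgHom : X.L →+* X.L) w) =
      underPlace ((ΨBase.map h).toAlgHom : (ΨBase.obj X).L →+* (ΨBase.obj X).L) (π w) := by
  classical
  obtain ⟨τ, hτ⟩ := exists_ringEquiv_coe_eq (F := F₁) h.toAlgHom
  obtain ⟨τ', hτ'⟩ := exists_ringEquiv_coe_eq (F := F₂) (ΨBase.map h).toAlgHom
  -- naturality of `Ψ^Φ` at the generator `δ_{w'}`, `w' := h w` (so that `h^* δ_{w'} = δ_w`):
  set w' : FinitePlace X.L := underPlace (τ : X.L →+* X.L) w with hw'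
  have hnat := E.natural h (Multiplicative.ofAdd (EffArithDivisor.single X.L (Sum.inr w')))
  have hl : (arithFrobenioidOps F₁ K₁).pull h (Multiplicative.ofAdd (EffArithDivisor.single X.L (Sum.inr w'))) =
      Multiplicative.ofAdd (EffArithDivisor.single X.L (Sum.inr w)) := by
    change Multiplicative.ofAdd (EffArithDivisor.pullback h.toAlgHom.toRingHom
      (EffArithDivisor.single X.L (Sum.inr w'))) = _
    rw [EffArithDivisor.single_inr, EffArithDivisor.single_inr, AlgHom.toRingHom_eq_coe, ← hτ,
      pullback_ringEquiv_single, hw', underPlace_ringEquiv_apply_symm]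
  have hr : (arithFrobenioidOps F₂ K₂).pull (ΨBase.map h)
        (Multiplicative.ofAdd (EffArithDivisor.single (ΨBase.obj X).L (Sum.inr (π w')))) =
      Multiplicative.ofAdd (EffArithDivisor.single (ΨBase.obj X).L
        (Sum.inr (underPlace (τ'.symm : (ΨBase.obj X).L →+* (ΨBase.obj X).L) (π w')))) := by
    change Multiplicative.ofAdd (EffArithDivisor.pullback (ΨBase.map h).toAlgHom.toRingHom
      (EffArithDivisor.single (ΨBase.obj X).L (Sum.inr (π w')))) = _
    rw [EffArithDivisor.single_inr, EffArithDivisor.single_inr, AlgHom.toRingHom_eq_coe, ← hτ',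
      pullback_ringEquiv_single]
  have hchain : Multiplicative.ofAdd (EffArithDivisor.single (ΨBase.obj X).L (Sum.inr (π w))) =
      Multiplicative.ofAdd (EffArithDivisor.single (ΨBase.obj X).L
        (Sum.inr (underPlace (τ'.symm : (ΨBase.obj X).L →+* (ΨBase.obj X).L) (π w')))) :=
    (((hπ w).symm.trans (congrArg (E.iso X) hl).symm).trans hnat).trans
      ((congrArg ((arithFrobenioidOps F₂ K₂).pull (ΨBase.map h)) (hπ w')).trans hr)
  have hinj : π w = underPlace (τ'.symm : (ΨBase.obj X).L →+* (ΨBase.obj X).L) (π w') := by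
    have h1 := Multiplicative.ofAdd.injective hchain
    rw [EffArithDivisor.single_inr, EffArithDivisor.single_inr] at h1
    exact EffArithDivisor.single_finite_injective h1
  rw [← hτ, ← hτ', ← hw', hinj, underPlace_ringEquiv_symm_apply]

end Arith

end Literature.AlgebraicGeometry.Frobenioids

end
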